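import Literature.NumberTheory.PAdicHodge.TateSenConditionKummerRoute
import Literature.NumberTheory.PAdicHodge.TateAlmostEtaleTamePackage
import HarnessLib

/-!
# Crux K★ (stmt-BirchSwinnertonDyer-22226) — line kato-lever — sub-skeleton for the (TS1) discharge
# by the elementary Kummer route (seat bsd-line-edix-p1 g10/g11, 2026-08-28), v3: NO stub left — (TS1) PROVED

K★ ⟸ F″ ⟸ {P1, hT₂, hP′, hDR}; every `H¹` statement under hP′ is granted on the cite-only Tate–Sen axiom
`Literature.NumberTheory.PAdicHodge.tate1967_TS1_completedAlgClosure`. Landed this session (Literature/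
NumberTheory/PAdicHodge/, all ACCEPTED, 0 sorry): KummerTraceOneElement, CyclotomicTowerPthPowers,
KummerDepth, TateAlmostEtaleKummerStep, TateAlmostEtaleIntegralBases, TateAlmostEtaleTwistedBasis,
TateAlmostEtalePackageStep, TateAlmostEtalePTower, TateAlmostEtaleEtaleStep, TateAlmostEtalePChain (D′1),
TateAlmostEtaleSylow (D′2), TateSenConditionOfAlmostEtale (bridge, incl. `TS1_of_almostEtale_fin`),
TateSenConditionKummerRoute (D′3: `tate1967_TS1_of_tame`).

v1 of this skeleton had four stubs (C, D′1, D′2, D′3); D′1–D′3 are theorems (g10); v3 (g11): the last stub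
(C) is the tree theorem `TateAlmostEtale.tamePackage` (`TateAlmostEtaleTamePackage`, over the tame structure
theorem `TateTameStructure.eq_adjoin_rootOfUnity_radical`, `TateTameValueGroup`, `TateTameTeichmuller`,
`TateAlmostEtalePrincipalUnitRoots`), and the fact itself is discharged in the tree as
`Literature.NumberTheory.PAdicHodge.tate1967_TS1_completedAlgClosure_holds` (`TateSenConditionHolds`).
0 sorries. BSD is not proved by any of this; K★ stays conditional on {P1, hT₂, hDR}.
-/

set_option linter.dupNamespace false

noncomputable section

open Polynomial IntermediateField Module ValuativeRel Field

namespace Summit.BirchSwinnertonDyer.BirchSwinnertonDyer.Cruxes.StarredOptimalManinUnitFiveSeven.KatoLeverTS1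

open Literature.NumberTheory.PAdicHodge
open Literature.NumberTheory.PAdicHodge.TateAlmostEtale
open Literature.NumberTheory.GaloisRepresentations
open Literature.NumberTheory.GaloisRepresentations.IsNonarchimedeanLocalField

/-- **(C) — PROVED (`TateAlmostEtale.tamePackage`): finite extensions of `K_∞ = ℚ_p(ζ_{p^∞})` inside `F̄` of
degree prime to `p` are almost-perfectoid** ((Γ): norms are `p`-th powers of norms; (U_s): every
integer is a `p`-th power modulo `p^s`, for some `s > 0`). Known: for `K_∞` itself
(`CyclotomicTowerPthPowers`), ascent along root-of-unity steps (`adjoin_rootOfUnity_package`) and étale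
power bases (`package_of_etale_powerBasis`), along Kummer `p`-steps (`adjoin_exists_norm_sub_pow_le`) and
`p`-power Galois towers (`pGalois_package_and_trace`, `pChain_package`). Missing: non-unit prime radical
steps and the structure of tame extensions of `K_∞` (Lang ANT II §5 Prop. 12), or descent along
prime-to-`p` extensions plus a radical tower containing `T`; or cite Scholze 2012 Thm 3.7(ii). -/
theorem stub_tamePackage {F : Type} [Field F] [ValuativeRel F] [TopologicalSpace F]
    [IsNonarchimedeanLocalField F] [CharZero F] {p : ℕ} [Fact p.Prime] (hp : valuation F p < 1)
    (T : IntermediateField (TateTrace.Kinf hp) (NormedAlgClosure F))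
    (hfin : FiniteDimensional (TateTrace.Kinf hp) T)
    (hd : ¬ p ∣ finrank (TateTrace.Kinf hp) T) :
    ∃ s : ℝ, 0 < s ∧ (∀ x ∈ T, x ≠ 0 → ∃ c ∈ T, ‖c‖ ^ p = ‖x‖) ∧
      (∀ u ∈ T, ‖u‖ ≤ 1 → ∃ w ∈ T, ‖u - w ^ p‖ ≤ ‖(p : NormedAlgClosure F)‖ ^ s) :=
  TateAlmostEtale.tamePackage hp T hfin hd

/-- **Composition BY NAME: the Tate–Sen axiom from the single stub (C).** -/
theorem tate1967_TS1_of_stubs : tate1967_TS1_completedAlgClosure :=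
  TateAlmostEtale.tate1967_TS1_of_tame (fun hp T hfin hd => stub_tamePackage hp T hfin hd)

end Summit.BirchSwinnertonDyer.BirchSwinnertonDyer.Cruxes.StarredOptimalManinUnitFiveSeven.KatoLeverTS1

end
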